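import Literature.Topology.FourManifolds.OpenSlabHomotopyEquiv
import Literature.Topology.FourManifolds.HCobordismLevelConnectivity

/-!
# The open slab around the critical values as a deformation retract of `W`: the explicit
# deformation, with a prescribed bottom level, and draining the bottom collar to `V`
# (Milnor 1965, Thm. 3.4 / Cor. 3.5)

Topic `Literature/Topology/FourManifolds` (infrastructure for the fact seat
`provefact-Literature.Geometry.Riemannian.LawsonMichelsohn1984_surrounding`: Wall's form of the
trading of `1`-handles under `π₁(W, V) = 0` — *Geometrical connectivity I* (1971) — has to
transport the hypothesis `π₁(W, V) = 0` from the boundary `V = g⁻¹(0)` to a regular level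
`g⁻¹(b₀)` just above it, inside `W`).  Everything here is **proved**.

`OpenSlabHomotopyEquiv.lean` / `OpenSlabSimplyConnected.lean` deform `W` into the open slab
`U = g⁻¹(ℓ₀, ℓ₁)` around the critical values in three moves (off the boundary along the
flow-out of a boundary-defining function, Cor. 3.5; up and down along the unit-speed flow of
`g` across the two critical-point-free end bands, Thm. 3.4), but only return the resulting
homotopy equivalence `U ≃ₕ W`.  This file runs the same construction with the lower target
level *prescribed* — any `b₀` with `ℓ₀ < b₀` below all critical values — and returns the
deformation itself together with what it does below `b₀`:

* `Cobordism.exists_deformation_openSlab` — a homotopy `R : [0, 1] × W → W` of the identity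
  with `R_s(U) ⊆ U`, `R₁(W) ⊆ U`, **`R_s = id` on the level `g = b₀`**, **`R₁({g ≤ b₀}) ⊆ {g = b₀}`**,
  and: **every point of `{g ≤ b₀}` is joined inside `{g ≤ b₀}` to a point of `inl(M) = g⁻¹(0)`**
  (drain it backwards along the unit-speed flow to a level inside the collar of the
  flow-out, then along the flow-out line down to the boundary).
* `FlowoutInput.Cover.exists_deformation_apply` — the first move with its level formula
  `f (R(s, z)) = f z + s (a - f z)` on `{f ≤ a}` (the tree's `exists_deformation` returns only
  inequalities).

## References

* J. Milnor, *Lectures on the h-cobordism theorem*, Princeton (1965), Thm. 3.4 and Cor. 3.5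
  with their proofs (PDF pp. 12–13). [MilnorHCobordism1965]
-/

open scoped Manifold ContDiff Topology unitInterval
open Set Function Filter Metric

noncomputable section

namespace Literature.Topology.FourManifolds

universe u

/-! ### The first move with its level formula -/

namespace FlowoutInput.Cover

variable {k : ℕ} {M : Type u} [TopologicalSpace M] [ChartedSpace (EuclideanHalfSpace (k + 1)) M]
  [IsManifold (𝓡∂ (k + 1)) ∞ M] [T2Space M] {D : FlowoutInput k M} (Γ : D.Cover)

/-- **The first move, with the level formula**: the homotopy `R(s, z) = Fl z (s (a - f z))` on
`{f ≤ a}` (identity elsewhere) of `FlowoutInput.Cover.exists_deformation`, returned with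
`f (R(s, z)) = f z + s (a - f z)` for `f z ≤ a`. [cite: MilnorHCobordism1965, Cor. 3.5 and proof of Thm. 3.4 (PDF pp. 12–13)] -/
theorem exists_deformation_apply :
    ∃ R : C(unitInterval × M, M), (∀ z, R (0, z) = z) ∧
      (∀ (s : unitInterval) (z), Γ.a ≤ D.f z → R (s, z) = z) ∧
      (∀ z, Γ.a ≤ D.f (R (1, z))) ∧
      ∀ (s : unitInterval) (z), D.f z ≤ Γ.a → D.f (R (s, z)) = D.f z + (s : ℝ) * (Γ.a - D.f z) := by
  classical
  have hfc : Continuous D.f := D.f_smooth.continuous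
  -- the formula
  set F : unitInterval × M → M := fun p =>
    if D.f p.2 ≤ Γ.a then Γ.Fl p.2 ((p.1 : ℝ) * (Γ.a - D.f p.2)) else p.2 with hF
  have htime : ∀ (s : unitInterval) (z : M), D.f z ≤ Γ.a →
      (s : ℝ) * (Γ.a - D.f z) ∈ Icc 0 Γ.a := by
    intro s z hz
    have h0 : 0 ≤ Γ.a - D.f z := sub_nonneg.2 hz
    have h1 : Γ.a - D.f z ≤ Γ.a := sub_le_self _ (D.f_nonneg z)
    exact ⟨mul_nonneg s.2.1 h0, (mul_le_of_le_one_left h0 s.2.2).trans h1⟩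
  have hFc : Continuous F := by
    refine continuous_if_le (hfc.comp continuous_snd) continuous_const ?_ continuousOn_snd
      fun p hp => ?_
    · have h1 : ContinuousOn (fun p : unitInterval × M => (p.2, (p.1 : ℝ) * (Γ.a - D.f p.2)))
          {p : unitInterval × M | D.f p.2 ≤ Γ.a} :=
        (continuous_snd.prodMk ((continuous_subtype_val.comp continuous_fst).mul
          (continuous_const.sub (hfc.comp continuous_snd)))).continuousOn
      refine Γ.continuousOn_Fl.comp h1 fun p hp => ⟨hp, htime p.1 p.2 hp⟩
    · show Γ.Fl p.2 ((p.1 : ℝ) * (Γ.a - D.f p.2)) = p.2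
      rw [hp, sub_self, mul_zero]
      exact Γ.Fl_zero hp.le
  refine ⟨⟨F, hFc⟩, fun z => ?_, fun s z hz => ?_, fun z => ?_, fun s z hz => ?_⟩
  · show F (0, z) = z
    simp only [hF]
    split_ifs with h
    · show Γ.Fl z (((0 : unitInterval) : ℝ) * (Γ.a - D.f z)) = z
      rw [show ((0 : unitInterval) : ℝ) = 0 from rfl, zero_mul]
      exact Γ.Fl_zero h
    · rfl
  · show F (s, z) = z
    simp only [hF]
    split_ifs with h
    · show Γ.Fl z ((s : ℝ) * (Γ.a - D.f z)) = z
      rw [le_antisymm h hz, sub_self, mul_zero]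
      exact Γ.Fl_zero h
    · rfl
  · show Γ.a ≤ D.f (F (1, z))
    simp only [hF]
    split_ifs with h
    · show Γ.a ≤ D.f (Γ.Fl z (((1 : unitInterval) : ℝ) * (Γ.a - D.f z)))
      rw [show ((1 : unitInterval) : ℝ) = 1 from rfl, one_mul,
        Γ.f_Fl h ⟨by linarith [D.f_nonneg z], sub_le_self _ (D.f_nonneg z)⟩]
      linarith
    · exact (not_le.1 h).le
  · show D.f (F (s, z)) = D.f z + (s : ℝ) * (Γ.a - D.f z)
    simp only [hF, if_pos hz]
    have ht := htime s z hz
    exact Γ.f_Fl hz ⟨by linarith [D.f_nonneg z, ht.1], ht.2⟩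

end FlowoutInput.Cover

/-! ### The deformation of `W` into the open slab -/

section Cobordism

variable {n : ℕ} {M N : Type u} [TopologicalSpace M] [ChartedSpace (EuclideanSpace ℝ (Fin n)) M]
  [TopologicalSpace N] [ChartedSpace (EuclideanSpace ℝ (Fin n)) N]

/-- **Milnor 1965, Thm. 3.4 / Cor. 3.5 at the ends: the deformation of `W` into the open slab,
with prescribed bottom level.**  For a Morse function `g` on the cobordism `c`, levels
`0 < ℓ₀ < b₀ < ℓ₁ < 1` such that every critical point of `g` has its value in `(b₀, ℓ₁)`, and
`W` nonempty, there is a homotopy `R : [0, 1] × W → W` with: `R(0, ·) = id`; each `R(s, ·)`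
maps the slab `U = g⁻¹(ℓ₀, ℓ₁)` into itself; `R(1, ·)` maps `W` into `U`; each `R(s, ·)` fixes
the level `g = b₀` pointwise; `R(1, ·)` maps `{g ≤ b₀}` into the level `g = b₀`; and every point
of `{g ≤ b₀}` is joined inside `{g ≤ b₀}` to a point of `inl(M)`.  (Construction of
`Cobordism.exists_homotopyEquiv_openSlab` with the lower push-up level taken to be `b₀`; the
last clause drains `{g ≤ b₀}` backwards along the unit-speed flow and the flow-out.)
[cite: MilnorHCobordism1965, Thm. 3.4 and Cor. 3.5 with their proofs (PDF pp. 12–13)] -/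
theorem Cobordism.exists_deformation_openSlab {c : Cobordism n M N} {g : c.W → ℝ}
    (hg : c.IsMorseFunction g) {ℓ₀ b₀ ℓ₁ : ℝ} (hℓ₀ : 0 < ℓ₀) (hℓ₀b₀ : ℓ₀ < b₀) (hb₀ℓ₁ : b₀ < ℓ₁)
    (hℓ₁ : ℓ₁ < 1) (hcrit : ∀ z ∈ criticalSet (𝓡∂ (n + 1)) g, g z ∈ Ioo b₀ ℓ₁) [Nonempty c.W] :
    ∃ R : C(I × c.W, c.W), (∀ z, R (0, z) = z) ∧
      (∀ (s : I), ∀ z ∈ g ⁻¹' Ioo ℓ₀ ℓ₁, R (s, z) ∈ g ⁻¹' Ioo ℓ₀ ℓ₁) ∧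
      (∀ z, R (1, z) ∈ g ⁻¹' Ioo ℓ₀ ℓ₁) ∧
      (∀ (s : I) (z : c.W), g z = b₀ → R (s, z) = z) ∧
      (∀ z, g z ≤ b₀ → g (R (1, z)) = b₀) ∧
      (∀ z, g z ≤ b₀ → ∃ x : M, JoinedIn (g ⁻¹' Iic b₀) z (c.inl x)) := by
  classical
  have hℓ₀₁ : ℓ₀ < ℓ₁ := hℓ₀b₀.trans hb₀ℓ₁
  have hcrit' : ∀ z ∈ criticalSet (𝓡∂ (n + 1)) g, g z ∈ Ioo ℓ₀ ℓ₁ := fun z hz =>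
    ⟨hℓ₀b₀.trans (hcrit z hz).1, (hcrit z hz).2⟩
  set U : Set c.W := g ⁻¹' Ioo ℓ₀ ℓ₁ with hUdef
  have hgs : ContMDiff (𝓡∂ (n + 1)) 𝓘(ℝ, ℝ) ∞ g := hg.isMorse.contMDiff
  have hgd : MDifferentiable (𝓡∂ (n + 1)) 𝓘(ℝ, ℝ) g := hgs.mdifferentiable (by simp)
  have hgc : Continuous g := hgs.continuous
  obtain ⟨z₀⟩ := ‹Nonempty c.W›
  ----------------------------------------------------------------------------------------------
  -- Step 1: off the boundary
  ----------------------------------------------------------------------------------------------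
  obtain ⟨D⟩ := c.nonempty_flowoutInput
  obtain ⟨Γ₀⟩ := D.nonempty_cover
  have hfc : Continuous D.f := D.f_smooth.continuous
  -- interior points and the values of `g`
  have hint_of_pos : ∀ z, 0 < D.f z → g z ∈ Ioo (0 : ℝ) 1 := by
    intro z hz
    refine hg.2.2.2.2 z (((𝓡∂ (n + 1)).isInteriorPoint_iff_not_isBoundaryPoint z).2 fun hb => ?_)
    exact hz.ne' ((D.f_eq_zero_iff z).2 hb)
  have hpos_of_int : ∀ z, g z ∈ Ioo (0 : ℝ) 1 → 0 < D.f z := by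
    intro z hz
    refine lt_of_le_of_ne (D.f_nonneg z) fun h0 => ?_
    have hb : (𝓡∂ (n + 1)).IsBoundaryPoint z := (D.f_eq_zero_iff z).1 h0.symm
    have hi := hg.isInteriorPoint_of_apply_mem_Ioo hz
    exact ((𝓡∂ (n + 1)).isInteriorPoint_iff_not_isBoundaryPoint z).1 hi hb
  -- a positive lower bound of `D.f` on the closed slab
  obtain ⟨d₀, hd₀, hd₀le⟩ : ∃ d₀ : ℝ, 0 < d₀ ∧ ∀ z, g z ∈ Icc ℓ₀ ℓ₁ → d₀ ≤ D.f z := by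
    by_cases hne : (g ⁻¹' Icc ℓ₀ ℓ₁).Nonempty
    · have hKc : IsCompact (g ⁻¹' Icc ℓ₀ ℓ₁) := (isClosed_Icc.preimage hgc).isCompact
      obtain ⟨z₁, hz₁, hmin⟩ := hKc.exists_isMinOn hne hfc.continuousOn
      refine ⟨D.f z₁, hpos_of_int z₁ ⟨hℓ₀.trans_le hz₁.1, hz₁.2.trans_lt hℓ₁⟩, fun z hz => ?_⟩
      exact (isMinOn_iff.1 hmin) z hz
    · exact ⟨1, one_pos, fun z hz => (hne ⟨z, hz⟩).elim⟩
  -- the cover with small height, and the first move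
  let Γ : D.Cover :=
    { T := Γ₀.T
      f_lt := Γ₀.f_lt
      a := min Γ₀.a (d₀ / 2)
      a_pos := lt_min Γ₀.a_pos (by positivity)
      a_le := fun y hy => (min_le_left _ _).trans (Γ₀.a_le y hy)
      cover := fun z hz => Γ₀.cover z (hz.trans (min_le_left _ _)) }
  have haU : ∀ z ∈ U, Γ.a < D.f z := fun z hz => by
    have h1 : Γ.a ≤ d₀ / 2 := min_le_right _ _
    have h2 := hd₀le z (Ioo_subset_Icc_self hz)
    linarith
  obtain ⟨R1, hR1_0, hR1_fix, hR1_1, hR1_f⟩ := Γ.exists_deformation_apply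
  have hapos : 0 < Γ.a := Γ.a_pos
  -- the values of `g` on `{a ≤ D.f}`
  have hK₁c : IsCompact {z : c.W | Γ.a ≤ D.f z} := (isClosed_le continuous_const hfc).isCompact
  have hK₁ne : {z : c.W | Γ.a ≤ D.f z}.Nonempty := ⟨R1 (1, z₀), hR1_1 z₀⟩
  have hK₁g : ∀ z, Γ.a ≤ D.f z → g z ∈ Ioo (0 : ℝ) 1 := fun z hz => hint_of_pos z (hapos.trans_le hz)
  obtain ⟨zmin, hzmin, hmin⟩ := hK₁c.exists_isMinOn hK₁ne hgc.continuousOn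
  obtain ⟨zmax, hzmax, hmax⟩ := hK₁c.exists_isMaxOn hK₁ne hgc.continuousOn
  set m₀ : ℝ := g zmin with hm₀
  set m₁ : ℝ := g zmax with hm₁
  have hm₀pos : 0 < m₀ := (hK₁g zmin hzmin).1
  have hm₁lt : m₁ < 1 := (hK₁g zmax hzmax).2
  have hm₀le : ∀ z, Γ.a ≤ D.f z → m₀ ≤ g z := fun z hz => (isMinOn_iff.1 hmin) z hz
  have hm₁ge : ∀ z, Γ.a ≤ D.f z → g z ≤ m₁ := fun z hz => (isMaxOn_iff.1 hmax) z hz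
  ----------------------------------------------------------------------------------------------
  -- Step 2: the levels `L ≤ L'` and the bands
  ----------------------------------------------------------------------------------------------
  obtain ⟨cmin, cmax, hc0, hc01, hc1, hcval⟩ : ∃ cmin cmax : ℝ, b₀ < cmin ∧ cmin ≤ cmax ∧ cmax < ℓ₁ ∧
      ∀ z ∈ criticalSet (𝓡∂ (n + 1)) g, cmin ≤ g z ∧ g z ≤ cmax := by
    have hfin : (criticalSet (𝓡∂ (n + 1)) g).Finite := IsMorse.finite_criticalSet_holds hg.isMorse
    by_cases hne : (criticalSet (𝓡∂ (n + 1)) g).Nonempty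
    · set T : Finset ℝ := hfin.toFinset.image g with hT
      have hTne : T.Nonempty := by
        obtain ⟨z, hz⟩ := hne
        exact ⟨g z, Finset.mem_image.2 ⟨z, hfin.mem_toFinset.2 hz, rfl⟩⟩
      have hTmem : ∀ v ∈ T, v ∈ Ioo b₀ ℓ₁ := by
        intro v hv
        obtain ⟨z, hz, rfl⟩ := Finset.mem_image.1 hv
        exact hcrit z (hfin.mem_toFinset.1 hz)
      refine ⟨T.min' hTne, T.max' hTne, (hTmem _ (T.min'_mem hTne)).1, T.min'_le_max' hTne,
        (hTmem _ (T.max'_mem hTne)).2, fun z hz => ?_⟩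
      have hv : g z ∈ T := Finset.mem_image.2 ⟨z, hfin.mem_toFinset.2 hz, rfl⟩
      exact ⟨T.min'_le _ hv, T.le_max' _ hv⟩
    · refine ⟨(b₀ + ℓ₁) / 2, (b₀ + ℓ₁) / 2, by linarith, le_rfl, by linarith, fun z hz => ?_⟩
      exact (hne ⟨z, hz⟩).elim
  set L : ℝ := b₀ with hL
  set L' : ℝ := (cmax + ℓ₁) / 2 with hL'
  set ε : ℝ := min ((cmin - L) / 2) ((L' - cmax) / 2) with hε
  have hε : 0 < ε := lt_min (by rw [hL]; linarith) (by rw [hL']; linarith)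
  have hℓ₀L : ℓ₀ < L := hℓ₀b₀
  have hLL' : L ≤ L' := by rw [hL, hL']; linarith
  have hL'ℓ₁ : L' < ℓ₁ := by rw [hL']; linarith
  have hLε : L + ε < cmin := by
    have : ε ≤ (cmin - L) / 2 := min_le_left _ _
    have : L < cmin := by rw [hL]; exact hc0
    linarith
  have hL'ε : cmax < L' - ε := by
    have : ε ≤ (L' - cmax) / 2 := min_le_right _ _
    have : cmax < L' := by rw [hL']; linarith
    linarith
  set p₀ : ℝ := min m₀ ℓ₀ / 2 with hp₀
  set p₁ : ℝ := (1 + max m₁ ℓ₁) / 2 with hp₁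
  have hp₀pos : 0 < p₀ := by rw [hp₀]; positivity
  have hp₀m₀ : p₀ < m₀ := by
    have : min m₀ ℓ₀ ≤ m₀ := min_le_left _ _
    rw [hp₀]; linarith
  have hp₀ℓ₀ : p₀ < ℓ₀ := by
    have : min m₀ ℓ₀ ≤ ℓ₀ := min_le_right _ _
    rw [hp₀]; linarith
  have hp₁lt : p₁ < 1 := by
    have : max m₁ ℓ₁ < 1 := max_lt hm₁lt hℓ₁
    rw [hp₁]; linarith
  have hm₁p₁ : m₁ < p₁ := by
    have : m₁ ≤ max m₁ ℓ₁ := le_max_left _ _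
    rw [hp₁]; linarith
  have hℓ₁p₁ : ℓ₁ < p₁ := by
    have : ℓ₁ ≤ max m₁ ℓ₁ := le_max_right _ _
    rw [hp₁]; linarith
  -- the unit-speed field on the two bands
  set Cb : Set c.W := g ⁻¹' (Icc p₀ (L + ε) ∪ Icc (L' - ε) p₁) with hCb
  have hCbc : IsClosed Cb := (isClosed_Icc.union isClosed_Icc).preimage hgc
  have hCbreg : ∀ z ∈ Cb, mfderiv (𝓡∂ (n + 1)) 𝓘(ℝ, ℝ) g z ≠ 0 := by
    intro z hz hcz
    obtain ⟨h1, h2⟩ := hcval z hcz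
    rcases hz with hz | hz
    · exact absurd hz.2 (not_le.2 (by linarith))
    · exact absurd hz.1 (not_le.2 (by linarith))
  obtain ⟨ξh, hξh⟩ := exists_contMDiffSection_mlineDeriv_eq_one_on hgs hCbc hCbreg
  obtain ⟨θ, hθ⟩ := hg.exists_isSmoothFlow_slabField ξh.contMDiff hp₀pos hp₁lt
  have hθc : Continuous θ := hθ.continuous
  have hYg : ∀ z, z ∈ Cb → g z ∈ Icc p₀ p₁ →
      mlineDeriv (𝓡∂ (n + 1)) g z (Cobordism.slabField g ξh p₀ p₁ z) = 1 := by
    intro z hzC hz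
    rw [Cobordism.mlineDeriv_slabField, slabCutoff_eq_one hp₀pos hp₁lt hz, one_mul]
    exact hξh z hzC
  ----------------------------------------------------------------------------------------------
  -- Step 3: the clocks
  ----------------------------------------------------------------------------------------------
  have hclock_up : ∀ z, p₀ < g z → g z ≤ L → ∀ t ∈ Icc 0 (L - g z), g (θ (t, z)) = g z + t := by
    intro z h1 h2 t ht
    have hderiv := fun s => hθ.hasDerivAt_comp hgd z s
    have hband : ∀ s, g (θ (s, z)) ∈ Ioo p₀ (L + ε) →
        mlineDeriv (𝓡∂ (n + 1)) g (θ (s, z)) (Cobordism.slabField g ξh p₀ p₁ (θ (s, z))) = 1 :=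
      fun s hs => hYg _ (Or.inl ⟨hs.1.le, hs.2.le⟩) ⟨hs.1.le, by linarith [hs.2]⟩
    have key := UnitSpeed.eq_add_of_deriv_eq_one hderiv hband (t₀ := 0) (T := L - g z)
      (by rw [hθ.map_zero]; exact h1) (by rw [hθ.map_zero]; linarith)
    have := key t ht
    rwa [zero_add, hθ.map_zero] at this
  have hclock_down : ∀ z, L' ≤ g z → g z < p₁ →
      ∀ t ∈ Icc 0 (g z - L'), g (θ (-t, z)) = g z - t := by
    intro z h1 h2 t ht
    have hθr := hθ.reverse
    have hgd' : MDifferentiable (𝓡∂ (n + 1)) 𝓘(ℝ, ℝ) fun y => 1 - g y := mdifferentiable_const_sub hgd 1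
    have hderiv := fun s => hθr.hasDerivAt_comp hgd' z s
    have hband : ∀ s, (1 - g (θ (-s, z))) ∈ Ioo (1 - p₁) (1 - (L' - ε)) →
        mlineDeriv (𝓡∂ (n + 1)) (fun y => 1 - g y) (θ (-s, z))
          ((-Cobordism.slabField g ξh p₀ p₁) (θ (-s, z))) = 1 := by
      intro s hs
      have hgs' : g (θ (-s, z)) ∈ Ioo (L' - ε) p₁ := ⟨by linarith [hs.2], by linarith [hs.1]⟩
      show mlineDeriv (𝓡∂ (n + 1)) (fun y => 1 - g y) (θ (-s, z))
        (-Cobordism.slabField g ξh p₀ p₁ (θ (-s, z))) = 1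
      rw [mlineDeriv_const_sub (hgd _), mlineDeriv_neg, neg_neg]
      exact hYg _ (Or.inr ⟨hgs'.1.le, hgs'.2.le⟩) ⟨by linarith [hgs'.1], hgs'.2.le⟩
    have key := UnitSpeed.eq_add_of_deriv_eq_one (g := fun s => 1 - g (θ (-s, z))) hderiv hband
      (t₀ := 0) (T := g z - L') (by simp only [neg_zero, hθ.map_zero]; linarith)
      (by simp only [neg_zero, hθ.map_zero]; linarith)
    have := key t ht
    simp only [zero_add, neg_zero, hθ.map_zero] at this
    linarith
  ----------------------------------------------------------------------------------------------
  -- Step 4: the three moves and their composite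
  ----------------------------------------------------------------------------------------------
  set T₂ : c.W → ℝ := fun z => max 0 (L - g z) with hT₂
  set T₃ : c.W → ℝ := fun z => max 0 (g z - L') with hT₃
  have hT₂c : Continuous T₂ := continuous_const.max (continuous_const.sub hgc)
  have hT₃c : Continuous T₃ := continuous_const.max (hgc.sub continuous_const)
  set R2 : unitInterval × c.W → c.W := fun p => θ ((p.1 : ℝ) * T₂ p.2, p.2) with hR2
  set R3 : unitInterval × c.W → c.W := fun p => θ (-((p.1 : ℝ) * T₃ p.2), p.2) with hR3
  have hR2c : Continuous R2 :=
    hθc.comp (((continuous_subtype_val.comp continuous_fst).mul (hT₂c.comp continuous_snd)).prodMk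
      continuous_snd)
  have hR3c : Continuous R3 :=
    hθc.comp (((continuous_subtype_val.comp continuous_fst).mul (hT₃c.comp continuous_snd)).neg.prodMk
      continuous_snd)
  -- the second move
  have hR2g : ∀ (s : unitInterval) (z), p₀ < g z → g z ≤ L →
      g (R2 (s, z)) = g z + (s : ℝ) * (L - g z) := by
    intro s z h1 h2
    have hT : T₂ z = L - g z := max_eq_right (by linarith)
    show g (θ ((s : ℝ) * T₂ z, z)) = _
    rw [hT]
    refine hclock_up z h1 h2 _ ⟨mul_nonneg s.2.1 (by linarith), ?_⟩
    exact mul_le_of_le_one_left (by linarith) s.2.2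
  have hR2fix : ∀ (s : unitInterval) (z), L ≤ g z → R2 (s, z) = z := by
    intro s z h
    have hT : T₂ z = 0 := max_eq_left (by linarith)
    show θ ((s : ℝ) * T₂ z, z) = z
    rw [hT, mul_zero, hθ.map_zero]
  have hR2U : ∀ (s : unitInterval), ∀ z ∈ U, R2 (s, z) ∈ U := by
    intro s z hz
    rcases le_or_gt (g z) L with h | h
    · have h1 := hR2g s z (hp₀ℓ₀.trans hz.1) h
      have h2 : 0 ≤ (s : ℝ) * (L - g z) := mul_nonneg s.2.1 (by linarith)
      have h3 : (s : ℝ) * (L - g z) ≤ L - g z := mul_le_of_le_one_left (by linarith) s.2.2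
      show g (R2 (s, z)) ∈ Ioo ℓ₀ ℓ₁
      rw [h1]
      exact ⟨by linarith [hz.1], by linarith⟩
    · rw [hR2fix s z h.le]; exact hz
  -- the third move
  have hR3g : ∀ (s : unitInterval) (z), L' ≤ g z → g z < p₁ →
      g (R3 (s, z)) = g z - (s : ℝ) * (g z - L') := by
    intro s z h1 h2
    have hT : T₃ z = g z - L' := max_eq_right (by linarith)
    show g (θ (-((s : ℝ) * T₃ z), z)) = _
    rw [hT]
    refine hclock_down z h1 h2 _ ⟨mul_nonneg s.2.1 (by linarith), ?_⟩
    exact mul_le_of_le_one_left (by linarith) s.2.2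
  have hR3fix : ∀ (s : unitInterval) (z), g z ≤ L' → R3 (s, z) = z := by
    intro s z h
    have hT : T₃ z = 0 := max_eq_left (by linarith)
    show θ (-((s : ℝ) * T₃ z), z) = z
    rw [hT, mul_zero, neg_zero, hθ.map_zero]
  have hR3U : ∀ (s : unitInterval), ∀ z ∈ U, R3 (s, z) ∈ U := by
    intro s z hz
    rcases lt_or_ge (g z) L' with h | h
    · rw [hR3fix s z h.le]; exact hz
    · have h1 := hR3g s z h (hz.2.trans hℓ₁p₁)
      have h2 : 0 ≤ (s : ℝ) * (g z - L') := mul_nonneg s.2.1 (by linarith)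
      have h3 : (s : ℝ) * (g z - L') ≤ g z - L' := mul_le_of_le_one_left (by linarith) s.2.2
      show g (R3 (s, z)) ∈ Ioo ℓ₀ ℓ₁
      rw [h1]
      exact ⟨by linarith, by linarith [hz.2]⟩
  -- the composite
  set Rt : unitInterval × c.W → c.W := fun p => R3 (p.1, R2 (p.1, R1 (p.1, p.2))) with hRt
  have hRtc : Continuous Rt := by
    refine hR3c.comp (continuous_fst.prodMk (hR2c.comp (continuous_fst.prodMk ?_)))
    exact R1.continuous.comp (continuous_fst.prodMk continuous_snd)
  have hRt0 : ∀ z, Rt (0, z) = z := by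
    intro z
    show R3 (0, R2 (0, R1 (0, z))) = z
    rw [hR1_0 z]
    have h2 : R2 (0, z) = z := by
      show θ (((0 : unitInterval) : ℝ) * T₂ z, z) = z
      rw [show ((0 : unitInterval) : ℝ) = 0 from rfl, zero_mul, hθ.map_zero]
    rw [h2]
    show θ (-(((0 : unitInterval) : ℝ) * T₃ z), z) = z
    rw [show ((0 : unitInterval) : ℝ) = 0 from rfl, zero_mul, neg_zero, hθ.map_zero]
  have hRtU : ∀ (s : unitInterval), ∀ z ∈ U, Rt (s, z) ∈ U := by
    intro s z hz
    show R3 (s, R2 (s, R1 (s, z))) ∈ U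
    rw [hR1_fix s z (haU z hz).le]
    exact hR3U s _ (hR2U s z hz)
  have hRt1 : ∀ z, Rt (1, z) ∈ U := by
    intro z
    set z₁ := R1 (1, z) with hz₁
    have hz₁K : Γ.a ≤ D.f z₁ := hR1_1 z
    have hg₁ : m₀ ≤ g z₁ ∧ g z₁ ≤ m₁ := ⟨hm₀le _ hz₁K, hm₁ge _ hz₁K⟩
    set z₂ := R2 (1, z₁) with hz₂
    have hg₂ : L ≤ g z₂ ∧ g z₂ ≤ max L m₁ := by
      rcases le_or_gt (g z₁) L with h | h
      · have h1 := hR2g 1 z₁ (hp₀m₀.trans_le hg₁.1) h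
        rw [show ((1 : unitInterval) : ℝ) = 1 from rfl, one_mul] at h1
        rw [hz₂, h1]
        exact ⟨le_of_eq (by ring), by linarith [le_max_left L m₁]⟩
      · rw [hz₂, hR2fix 1 z₁ h.le]
        exact ⟨h.le, hg₁.2.trans (le_max_right _ _)⟩
    have hg₂p₁ : g z₂ < p₁ := hg₂.2.trans_lt (max_lt (hLL'.trans_lt (hL'ℓ₁.trans hℓ₁p₁)) hm₁p₁)
    show R3 (1, z₂) ∈ U
    rcases lt_or_ge (g z₂) L' with h | h
    · rw [hR3fix 1 z₂ h.le]
      exact ⟨hℓ₀L.trans_le hg₂.1, h.trans hL'ℓ₁⟩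
    · have h1 := hR3g 1 z₂ h hg₂p₁
      rw [show ((1 : unitInterval) : ℝ) = 1 from rfl, one_mul] at h1
      show g (R3 (1, z₂)) ∈ Ioo ℓ₀ ℓ₁
      rw [h1]
      exact ⟨by linarith, by linarith⟩
  ----------------------------------------------------------------------------------------------
  -- Step 5: the level `b₀ = L` is fixed and `{g ≤ b₀}` is pushed onto it
  ----------------------------------------------------------------------------------------------
  -- points of `{D.f ≤ a}` lie outside the closed slab
  have hslab_a : ∀ w, D.f w ≤ Γ.a → g w ∉ Icc ℓ₀ ℓ₁ := fun w hw hgw => by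
    have h1 := hd₀le w hgw
    have h2 : Γ.a ≤ d₀ / 2 := min_le_right _ _
    linarith
  have ha_of_slab : ∀ w, g w ∈ Icc ℓ₀ ℓ₁ → Γ.a ≤ D.f w := fun w hw => by
    by_contra h
    exact hslab_a w (not_le.1 h).le hw
  -- the first move keeps `{D.f ≤ a}` inside `{D.f ≤ a}`
  have hR1_fa : ∀ (s : I) (z), D.f z ≤ Γ.a → D.f (R1 (s, z)) ≤ Γ.a := by
    intro s z hz
    rw [hR1_f s z hz]
    have h0 : 0 ≤ Γ.a - D.f z := sub_nonneg.2 hz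
    have h1 : (s : ℝ) * (Γ.a - D.f z) ≤ Γ.a - D.f z := mul_le_of_le_one_left h0 s.2.2
    linarith
  -- a continuous curve through `{D.f ≤ a}` starting below `ℓ₁` stays below `ℓ₀`
  have hstay : ∀ (P : I → c.W), Continuous P → (∀ t, D.f (P t) ≤ Γ.a) → g (P 0) < ℓ₁ →
      ∀ t, g (P t) < ℓ₀ := by
    intro P hP hPa h0 t
    have hg0 : g (P 0) < ℓ₀ := by
      by_contra hge
      exact hslab_a _ (hPa 0) ⟨not_lt.1 hge, h0.le⟩
    by_contra hge
    rw [not_lt] at hge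
    set G : ℝ → ℝ := fun r => g (P (projIcc 0 1 zero_le_one r)) with hG
    have hGc : Continuous G := hgc.comp (hP.comp continuous_projIcc)
    have hG0 : G 0 = g (P 0) := by simp [hG, projIcc_left]
    have hGt : G t = g (P t) := by simp [hG, projIcc_val]
    obtain ⟨r, -, hval⟩ := intermediate_value_Icc (show (0 : ℝ) ≤ t from t.2.1) hGc.continuousOn
      (show ℓ₀ ∈ Icc (G 0) (G t) from ⟨by rw [hG0]; exact hg0.le, by rw [hGt]; exact hge⟩)
    exact hslab_a _ (hPa _) ⟨hval.ge, hval.le.trans hℓ₀₁.le⟩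
  have hR1_lt : ∀ (s : I) (z), D.f z ≤ Γ.a → g z < ℓ₁ → g (R1 (s, z)) < ℓ₀ := by
    intro s z hz hgz
    have h := hstay (fun s' => R1 (s', z)) (R1.continuous.comp (continuous_id.prodMk continuous_const))
      (fun s' => hR1_fa s' z hz) (by rw [hR1_0]; exact hgz) s
    exact h
  -- the level `b₀` is fixed
  have hfixL : ∀ (s : I) (z : c.W), g z = b₀ → Rt (s, z) = z := by
    intro s z hz
    have hza : Γ.a ≤ D.f z := ha_of_slab z (by rw [hz]; exact ⟨hℓ₀b₀.le, hb₀ℓ₁.le⟩)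
    show R3 (s, R2 (s, R1 (s, z))) = z
    rw [hR1_fix s z hza, hR2fix s z (by rw [hz]), hR3fix s z (by rw [hz]; exact hLL')]
  -- `{g ≤ b₀}` is pushed onto the level `b₀`
  have hpushL : ∀ z, g z ≤ b₀ → g (Rt (1, z)) = b₀ := by
    intro z hz
    set z₁ := R1 (1, z) with hz₁
    have hz₁K : Γ.a ≤ D.f z₁ := hR1_1 z
    have hg₁ : m₀ ≤ g z₁ := hm₀le _ hz₁K
    have hg₁L : g z₁ ≤ L := by
      by_cases hza : Γ.a ≤ D.f z
      · rw [hz₁, hR1_fix 1 z hza]; exact hz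
      · exact ((hR1_lt 1 z (not_le.1 hza).le (hz.trans_lt hb₀ℓ₁)).trans hℓ₀L).le
    have h1 := hR2g 1 z₁ (hp₀m₀.trans_le hg₁) hg₁L
    rw [show ((1 : unitInterval) : ℝ) = 1 from rfl, one_mul, add_sub_cancel] at h1
    show g (R3 (1, R2 (1, z₁))) = b₀
    rw [hR3fix 1 _ (by rw [h1]; exact hLL'), h1]
  ----------------------------------------------------------------------------------------------
  -- Step 6: draining `{g ≤ b₀}` to the incoming boundary inside `{g ≤ b₀}`
  ----------------------------------------------------------------------------------------------
  -- boundary points below `ℓ₀` are points of `inl M`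
  have hinl : ∀ w, w ∈ (𝓡∂ (n + 1)).boundary c.W → g w < ℓ₀ → ∃ x : M, c.inl x = w := by
    intro w hw hgw
    rw [← c.range_inl_union_range_inr] at hw
    rcases hw with hw | hw
    · exact hw
    · have h1 : g w = 1 := by
        have : w ∈ g ⁻¹' {1} := by rw [hg.preimage_one]; exact hw
        exact this
      linarith
  -- (A) from `{D.f ≤ a}`: along the flow-out, backwards to the boundary
  have hdrainA : ∀ w, D.f w ≤ Γ.a → g w < ℓ₁ → ∃ x : M, JoinedIn (g ⁻¹' Iic b₀) w (c.inl x) := by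
    intro w hw hgw
    have hf0 : 0 ≤ D.f w := D.f_nonneg w
    set P : I → c.W := fun t => Γ.Fl w (-((t : ℝ) * D.f w)) with hP
    have htime : ∀ t : I, -((t : ℝ) * D.f w) ∈ Icc (-D.f w) Γ.a := fun t => by
      constructor
      · have : (t : ℝ) * D.f w ≤ D.f w := mul_le_of_le_one_left hf0 t.2.2
        linarith
      · have : 0 ≤ (t : ℝ) * D.f w := mul_nonneg t.2.1 hf0
        linarith [Γ.a_pos]
    have hPc : Continuous P := by
      have h1 : ContinuousOn (Γ.Fl w) (Icc (-D.f w) Γ.a) := (Γ.isMIntegralCurveOn_Fl hw).continuousOn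
      exact h1.comp_continuous (by fun_prop) htime
    have hPf : ∀ t, D.f (P t) = D.f w - (t : ℝ) * D.f w := fun t => by
      show D.f (Γ.Fl w (-((t : ℝ) * D.f w))) = _
      rw [Γ.f_Fl hw (htime t)]; ring
    have hPa : ∀ t, D.f (P t) ≤ Γ.a := fun t => by
      rw [hPf t]
      have : 0 ≤ (t : ℝ) * D.f w := mul_nonneg t.2.1 hf0
      linarith
    have hP0 : P 0 = w := by
      show Γ.Fl w (-(((0 : I) : ℝ) * D.f w)) = w
      rw [show ((0 : I) : ℝ) = 0 from rfl, zero_mul, neg_zero, Γ.Fl_zero hw]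
    have hP1 : P 1 = Γ.ret w := by
      show Γ.Fl w (-(((1 : I) : ℝ) * D.f w)) = Γ.Fl w (-D.f w)
      rw [show ((1 : I) : ℝ) = 1 from rfl, one_mul]
    have hPlt : ∀ t, g (P t) < ℓ₀ := hstay P hPc hPa (by rw [hP0]; exact hgw)
    obtain ⟨x, hx⟩ := hinl (Γ.ret w) (Γ.ret_mem_boundary hw) (by rw [← hP1]; exact hPlt 1)
    refine ⟨x, ⟨⟨P, hPc⟩, hP0, by rw [hx]; exact hP1⟩, fun t => ?_⟩
    show g (P t) ≤ b₀
    exact ((hPlt t).trans hℓ₀b₀).le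
  -- the clock of the reversed flow in the lower band
  set m' : ℝ := (p₀ + m₀) / 2 with hm'
  have hp₀m' : p₀ < m' := by rw [hm']; linarith
  have hm'm₀ : m' < m₀ := by rw [hm']; linarith
  have hLεp₁ : L + ε < p₁ := by linarith
  have hclock_low : ∀ z, m' ≤ g z → g z ≤ L →
      ∀ t ∈ Icc 0 (g z - m'), g (θ (-t, z)) = g z - t := by
    intro z h1 h2 t ht
    have hθr := hθ.reverse
    have hgd' : MDifferentiable (𝓡∂ (n + 1)) 𝓘(ℝ, ℝ) fun y => 1 - g y := mdifferentiable_const_sub hgd 1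
    have hderiv := fun s => hθr.hasDerivAt_comp hgd' z s
    have hband : ∀ s, (1 - g (θ (-s, z))) ∈ Ioo (1 - (L + ε)) (1 - p₀) →
        mlineDeriv (𝓡∂ (n + 1)) (fun y => 1 - g y) (θ (-s, z))
          ((-Cobordism.slabField g ξh p₀ p₁) (θ (-s, z))) = 1 := by
      intro s hs
      have hgs' : g (θ (-s, z)) ∈ Ioo p₀ (L + ε) := ⟨by linarith [hs.2], by linarith [hs.1]⟩
      show mlineDeriv (𝓡∂ (n + 1)) (fun y => 1 - g y) (θ (-s, z))
        (-Cobordism.slabField g ξh p₀ p₁ (θ (-s, z))) = 1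
      rw [mlineDeriv_const_sub (hgd _), mlineDeriv_neg, neg_neg]
      exact hYg _ (Or.inl ⟨hgs'.1.le, hgs'.2.le⟩) ⟨hgs'.1.le, by linarith [hgs'.2]⟩
    have key := UnitSpeed.eq_add_of_deriv_eq_one (g := fun s => 1 - g (θ (-s, z))) hderiv hband
      (t₀ := 0) (T := g z - m') (by simp only [neg_zero, hθ.map_zero]; linarith)
      (by simp only [neg_zero, hθ.map_zero]; linarith)
    have := key t ht
    simp only [zero_add, neg_zero, hθ.map_zero] at this
    linarith
  -- (B) from `{m₀ ≤ g ≤ b₀}`: backwards along `θ` down to the level `m'`, then (A)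
  have hdrain : ∀ z, g z ≤ b₀ → ∃ x : M, JoinedIn (g ⁻¹' Iic b₀) z (c.inl x) := by
    intro z hz
    by_cases hza : D.f z ≤ Γ.a
    · exact hdrainA z hza (hz.trans_lt hb₀ℓ₁)
    · have hgz : m₀ ≤ g z := hm₀le z (not_le.1 hza).le
      have hT : 0 ≤ g z - m' := by linarith
      set Q : I → c.W := fun t => θ (-((t : ℝ) * (g z - m')), z) with hQ
      have hQc : Continuous Q :=
        hθc.comp (((continuous_subtype_val).mul continuous_const).neg.prodMk continuous_const)
      have hQg : ∀ t : I, g (Q t) = g z - (t : ℝ) * (g z - m') := fun t =>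
        hclock_low z (by linarith) hz _ ⟨mul_nonneg t.2.1 hT, mul_le_of_le_one_left hT t.2.2⟩
      have hQ0 : Q 0 = z := by
        show θ (-(((0 : I) : ℝ) * (g z - m')), z) = z
        rw [show ((0 : I) : ℝ) = 0 from rfl, zero_mul, neg_zero, hθ.map_zero]
      set w : c.W := Q 1 with hw
      have hgw : g w = m' := by
        rw [hw, hQg 1, show ((1 : I) : ℝ) = 1 from rfl, one_mul]; ring
      have hwa : D.f w ≤ Γ.a := by
        by_contra h
        have := hm₀le w (not_le.1 h).le
        linarith
      obtain ⟨x, hx⟩ := hdrainA w hwa (by rw [hgw]; linarith)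
      have hzw : JoinedIn (g ⁻¹' Iic b₀) z w := by
        refine ⟨⟨⟨Q, hQc⟩, hQ0, rfl⟩, fun t => ?_⟩
        show g (Q t) ≤ b₀
        rw [hQg t]
        have : 0 ≤ (t : ℝ) * (g z - m') := mul_nonneg t.2.1 hT
        linarith
      exact ⟨x, hzw.trans hx⟩
  ----------------------------------------------------------------------------------------------
  -- Conclusion.
  ----------------------------------------------------------------------------------------------
  exact ⟨⟨Rt, hRtc⟩, hRt0, hRtU, hRt1, hfixL, hpushL, hdrain⟩

end Cobordism

end Literature.Topology.FourManifolds

end
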